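import Literature.NumberTheory.LFunctions.RayClassLFunctionImprimitive
import Literature.NumberTheory.LFunctions.RayClassSmoothedSums
import Literature.NumberTheory.LFunctions.ClassGroupLFunctionZeroFreeRegionDegreeUniform
import Literature.NumberTheory.LFunctions.DedekindPsiGRHBound
import HarnessLib

/-!
# The zero-free region for Hecke `L`-functions of ray class characters, with an ABSOLUTE constant
# (Thorner–Zaman 2019 Theorem 3.1 / Lagarias–Odlyzko Lemma 8.1, uniformly in the field, the modulus and the degree)

Topic `Literature/NumberTheory/LFunctions`, namespace `Literature.NumberTheory.LFunctions`.
Everything here is PROVED (one definition with body, theorems; no named facts).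

The ray-class counterpart of the tree's `ClassGroupLFunctionZeroFreeRegionDegreeUniform.lean` (conductor `1`).
For a ray class character `ψ mod 𝔪 ≠ 0` of the number field `K`, non-principal on the primes `∤ 𝔪`, with primitive
data `D` (`χ₀ mod 𝔣`, entire `L`), the size-functional engine `DegreeUniformTwistedZeroFreeRegion.lean` is fed with
  `𝓛(t) = M_{K,𝔪}(t) = log|d_K| + log N𝔪 + 3 n_K + (n_K + 1) log(|t| + 7)`   (`modDiscBound K 𝔪 t`),
`F = L_𝔪(·, ψ)` (the entire imprimitive `L`-function `D.LMod`), `Λ₀ = Λ_K`, `Λ₁ = Λ_ψ`, `Λ₂ = Λ_{ψ²}` (twists by the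
coefficients `mod 𝔪`), and the ABSOLUTE parameters `η = 1`, `G = 2`, `G' = 11`, `K₀ = 77760`, `C₂ = 77761`:
* `degreeUniformTwistedZFRData_rayClass_of_ne` / `_of_eq` — the data (`ψ²` non-principal, `pole = false`;
  `ψ²` principal, `pole = true`);
* `exists_zeroFree_rayClass_absolute` — **TZ Theorem 3.1 (zero-free region) for Hecke `L`-functions of ray class
  characters, with an absolute constant**: there is `c > 0` such that for EVERY number field `K`, modulus `𝔪 ≠ 0`,
  ray class character `ψ mod 𝔪` non-principal on the primes `∤ 𝔪`, primitive data `D`, and every zero `ρ = β + iγ`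
  of `L(s, χ₀)` with `β > 1 − c/M_{K,𝔪}(γ)`: `ψ² is principal` (`ψ(𝔭) = ±1` off `𝔪`) and `γ = 0`.
(That there is at most one such exceptional zero among ALL `ψ mod 𝔪` incl. `ζ_K`, and that it is simple —
Landau–Page — is not in this file.)

## References
* [ThornerZaman2019] J. Thorner, A. Zaman, Algebra & Number Theory 13 (2019), Theorem 3.1.
* [LagariasOdlyzko1977] J. C. Lagarias, A. M. Odlyzko (1977), Lemmas 5.3, 5.6, 8.1.
* [MontgomeryVaughan2007] H. L. Montgomery, R. C. Vaughan, *Multiplicative Number Theory I*, §11.1.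
-/

noncomputable section

open scoped NumberField nonZeroDivisors ComplexConjugate
open Complex Filter Topology Set Metric NumberField IsDedekindDomain Finset

namespace Literature.NumberTheory.LFunctions

open Literature.NumberTheory.LFunctions.NumberField Literature.NumberTheory.LFunctions.LogFreeLocal
open scoped Classical

variable {K : Type*} [Field K] [NumberField K] {𝔪 : Ideal (𝓞 K)} {ψ : HeightOneSpectrum (𝓞 K) → ℂ}

/-! ### The size functional `M_{K,𝔪}(t) = M_K(t) + log N𝔪` -/

variable (K) in
/-- The size functional `M_{K,𝔪}(t) = log|d_K| + log N𝔪 + 3n_K + (n_K+1) log(|t|+7)` (`= discBound K t + log N𝔪`).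
[cite: ThornerZaman2019, Theorem 3.1] -/
def modDiscBound (𝔪 : Ideal (𝓞 K)) (t : ℝ) : ℝ := discBound K t + Real.log (Ideal.absNorm 𝔪 : ℕ)

/-- `log N𝔪 ≥ 0`. [cite: ThornerZaman2019, Theorem 3.1] -/
theorem log_absNorm_nonneg (𝔪 : Ideal (𝓞 K)) : 0 ≤ Real.log (Ideal.absNorm 𝔪 : ℕ) := Real.log_natCast_nonneg _

/-- `M_K(t) ≤ M_{K,𝔪}(t)`, `1 ≤ M_{K,𝔪}(t)` and the size-functional axioms. [cite: ThornerZaman2019, Theorem 3.1] -/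
theorem discBound_le_modDiscBound (𝔪 : Ideal (𝓞 K)) (t : ℝ) : discBound K t ≤ modDiscBound K 𝔪 t := by
  rw [modDiscBound]; linarith [log_absNorm_nonneg 𝔪]

/-- `1 ≤ M_{K,𝔪}(t)`. [cite: ThornerZaman2019, Theorem 3.1] -/
theorem one_le_modDiscBound (𝔪 : Ideal (𝓞 K)) (t : ℝ) : 1 ≤ modDiscBound K 𝔪 t :=
  (one_le_discBound K t).trans (discBound_le_modDiscBound 𝔪 t)

/-- `ℳ(t) ≤ M_{K,𝔪}(t)` (`rayDiscBound = log(|d_K|N𝔪) + 3n + n log(|t|+7)`). [cite: ThornerZaman2019, Theorem 3.1] -/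
theorem rayDiscBound_le_modDiscBound (h𝔪 : 𝔪 ≠ ⊥) (t : ℝ) : rayDiscBound K 𝔪 t ≤ modDiscBound K 𝔪 t := by
  rw [rayDiscBound, modDiscBound, discBound]
  have hd : (0 : ℝ) < ((NumberField.discr K).natAbs : ℝ) := by exact_mod_cast Int.natAbs_pos.mpr (discr_ne_zero K)
  have hm : (0 : ℝ) < ((Ideal.absNorm 𝔪 : ℕ) : ℝ) := by
    exact_mod_cast Nat.pos_of_ne_zero (by rwa [Ne, Ideal.absNorm_eq_zero_iff])
  rw [Real.log_mul hd.ne' hm.ne']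
  have : 0 ≤ Real.log (|t| + 7) := Real.log_nonneg (by linarith [abs_nonneg t])
  nlinarith

/-! ### The coefficients `Λ_ψ`, `Λ_{ψ²}` -/

/-- The coefficient homomorphism of `ψ²` is the square of that of `ψ`. [cite: MontgomeryVaughan2007, Lemma 11.2] -/
theorem rayClassCoeffHom_sq (𝔪 : Ideal (𝓞 K)) (ψ : HeightOneSpectrum (𝓞 K) → ℂ) (I : Ideal (𝓞 K)) :
    rayClassCoeffHom 𝔪 (fun v ↦ ψ v ^ 2) I = rayClassCoeffHom 𝔪 ψ I ^ 2 := by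
  rw [rayClassCoeffHom_apply, rayClassCoeffHom_apply, rayClassCoeff, rayClassCoeff]
  split_ifs with h
  · exact idealPow_pow_apply ψ 2 h.1
  · simp

/-! ### The datum -/

namespace RayClassPrimitiveData

/-- `|ψ(𝔭)| ≤ 1` off `𝔪`. [cite: ThornerZaman2019, Theorem 3.1] -/
theorem norm_psi_le_one (D : RayClassPrimitiveData 𝔪 ψ) :
    ∀ v : HeightOneSpectrum (𝓞 K), ¬ 𝔪 ≤ v.asIdeal → ‖ψ v‖ ≤ 1 := fun v hv ↦ by
  rw [← D.agree v hv]; exact D.norm_le_one v (fun h ↦ hv (D.le.trans h))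

/-- `|ψ(𝔭)²| ≤ 1` off `𝔪`. [cite: ThornerZaman2019, Theorem 3.1] -/
theorem norm_psi_sq_le_one (D : RayClassPrimitiveData 𝔪 ψ) :
    ∀ v : HeightOneSpectrum (𝓞 K), ¬ 𝔪 ≤ v.asIdeal → ‖ψ v ^ 2‖ ≤ 1 := fun v hv ↦ by
  rw [norm_pow]; exact pow_le_one₀ (norm_nonneg _) (D.norm_psi_le_one v hv)

variable (D : RayClassPrimitiveData 𝔪 ψ)

/-- The fields of `DegreeUniformTwistedZFRData` shared by both cases: `Re L(Λ_K,σ)`, the growth `|L_𝔪(s,ψ)| ≤ e^{2M(t)}`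
(`0 < σ ≤ 3`) and the lower bound `|L_𝔪(1 + 1/32 + it, ψ)| ≥ e^{−11 M(t)}`. [cite: ThornerZaman2019, Theorem 3.1] -/
theorem zfrData_common (hnt : ∃ v : HeightOneSpectrum (𝓞 K), ¬ 𝔪 ≤ v.asIdeal ∧ ψ v ≠ 1) :
    (∀ σ : ℝ, 1 < σ → σ ≤ 2 →
      (LSeries (fun m ↦ (vonMangoldtNorm K m : ℂ)) σ).re ≤ 1 / (σ - 1) + 77760 * modDiscBound K 𝔪 0) ∧
    (∀ s : ℂ, 1 - (1 : ℝ) < s.re → s.re ≤ 3 → ‖D.LMod s‖ ≤ Real.exp (2 * modDiscBound K 𝔪 s.im)) ∧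
    (∀ t : ℝ, Real.exp (-(11 * modDiscBound K 𝔪 t)) ≤ ‖D.LMod (1 + 1 / 32 + t * I)‖) := by
  have h𝔪 := D.modulus_ne_bot
  refine ⟨fun σ hσ hσ2 ↦ ?_, fun s hs hs3 ↦ ?_, fun t ↦ ?_⟩
  · have h := re_LSeries_vonMangoldtNorm_le (K := K) (s := (σ : ℂ)) (by simpa using hσ) (by simpa using hσ2)
    have h1 : (1 / ((σ : ℂ) - 1)).re = 1 / (σ - 1) := by
      rw [show (σ : ℂ) - 1 = ((σ - 1 : ℝ) : ℂ) by push_cast; ring, ← Complex.ofReal_one, ← Complex.ofReal_div,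
        Complex.ofReal_re]
    rw [h1, Complex.ofReal_im] at h
    have := discBound_le_modDiscBound (K := K) 𝔪 0
    linarith
  · have hs0 : 0 ≤ s.re := by linarith
    refine (D.norm_LMod_le hnt hs0 hs3).trans ?_
    set n : ℕ := Module.finrank ℚ K with hn
    have hd : (1 : ℝ) ≤ ((discr K).natAbs : ℝ) := by exact_mod_cast Int.natAbs_pos.mpr (discr_ne_zero K)
    have hm : (1 : ℝ) ≤ ((Ideal.absNorm 𝔪 : ℕ) : ℝ) := by
      exact_mod_cast Nat.one_le_iff_ne_zero.mpr (by rwa [Ne, Ideal.absNorm_eq_zero_iff])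
    have hτ : (0 : ℝ) < |s.im| + 6 := by positivity
    -- `e^{2M} = (d N𝔪)² e^{6n} (|t|+7)^{2n+2}`
    have hexp : Real.exp (2 * modDiscBound K 𝔪 s.im) = (((discr K).natAbs : ℝ) * ((Ideal.absNorm 𝔪 : ℕ) : ℝ)) ^ 2 *
        Real.exp (6 * n) * (|s.im| + 7) ^ (2 * (n + 1)) := by
      rw [modDiscBound, discBound, ← hn]
      have h7 : (0 : ℝ) < |s.im| + 7 := by positivity
      rw [show 2 * (Real.log ((discr K).natAbs : ℝ) + 3 * n + ((n : ℝ) + 1) * Real.log (|s.im| + 7) +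
          Real.log (Ideal.absNorm 𝔪 : ℕ)) = 2 * (Real.log ((discr K).natAbs : ℝ) + Real.log (Ideal.absNorm 𝔪 : ℕ)) +
          6 * n + ((2 * (n + 1) : ℕ) : ℝ) * Real.log (|s.im| + 7) by push_cast; ring,
        Real.exp_add, Real.exp_add, ← Real.log_mul (by positivity) (by positivity), Real.exp_nat_mul, Real.exp_log h7,
        show 2 * Real.log (((discr K).natAbs : ℝ) * ((Ideal.absNorm 𝔪 : ℕ) : ℝ)) = ((2 : ℕ) : ℝ) *
          Real.log (((discr K).natAbs : ℝ) * ((Ideal.absNorm 𝔪 : ℕ) : ℝ)) by norm_num, Real.exp_nat_mul,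
        Real.exp_log (by positivity)]
    rw [hexp]
    have h1 : (|s.im| + 6) ^ n ≤ (|s.im| + 7) ^ (2 * (n + 1)) := by
      calc (|s.im| + 6) ^ n ≤ (|s.im| + 7) ^ n := pow_le_pow_left₀ hτ.le (by linarith) _
        _ ≤ (|s.im| + 7) ^ (2 * (n + 1)) := pow_le_pow_right₀ (by linarith [abs_nonneg s.im]) (by omega)
    have h2 : Real.exp (2 * n) ≤ Real.exp (6 * n) := Real.exp_le_exp.mpr (by have : (0:ℝ) ≤ n := Nat.cast_nonneg _; linarith)
    have h3 : ((discr K).natAbs : ℝ) * ((Ideal.absNorm 𝔪 : ℕ) : ℝ) ^ 2 ≤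
        (((discr K).natAbs : ℝ) * ((Ideal.absNorm 𝔪 : ℕ) : ℝ)) ^ 2 := by
      rw [mul_pow]; nlinarith
    exact mul_le_mul (mul_le_mul h3 h2 (by positivity) (by positivity)) h1 (by positivity) (by positivity)
  · have hre : (1 + 1 / 32 + t * I : ℂ).re = 1 + 1 / 32 := by simp
    have hs1 : 1 < (1 + 1 / 32 + t * I : ℂ).re := by rw [hre]; norm_num
    rw [D.LMod_eq hs1]
    refine le_trans ?_ (exp_neg_finrank_div_le_norm_rayClassLSeries h𝔪 D.norm_psi_le_one hs1)
    rw [Real.exp_le_exp, hre, show (1 : ℝ) + 1 / 32 - 1 = 1 / 32 by norm_num, neg_le_neg_iff]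
    have h3 := three_mul_finrank_le_discBound (K := K) t
    have h4 := discBound_le_modDiscBound (K := K) 𝔪 t
    have h0 : (0 : ℝ) ≤ Module.finrank ℚ K := Nat.cast_nonneg _
    rw [div_eq_mul_inv, show ((1 : ℝ) / 32)⁻¹ = 32 by norm_num]
    nlinarith

/-- `L_𝔪'/L_𝔪 = −L(Λ_ψ)` on `σ > 1`. [cite: LagariasOdlyzko1977, §5 (5.2)] -/
theorem logDeriv_LMod_eq {s : ℂ} (hs : 1 < s.re) :
    deriv D.LMod s / D.LMod s = -LSeries (twistVonMangoldt K (rayClassCoeffHom 𝔪 ψ)) s := by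
  have h := neg_logDeriv_continuation_eq_LSeries D.modulus_ne_bot D.norm_psi_le_one (L := D.LMod)
    (fun z hz ↦ D.LMod_eq hz) hs
  rw [← h, neg_neg]

/-- **`Re L(Λ_{ψ²}, s) ≤ 77761 M_{K,𝔪}(t)`** for `1 < σ ≤ 2` when `ψ²` is non-principal: `L(Λ_{ψ²}) = −L_𝔪'/L_𝔪(·, ψ²)
= −L'/L(·, (ψ²)₀) − P'/P` with `Re(−L'/L) ≤ 77760 ℳ` (local partial fraction) and `|P'/P| ≤ log N𝔪`.
[cite: ThornerZaman2019, Lemma 2.6] -/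
theorem re_LSeries_twist_sq_le (h2 : ∃ v : HeightOneSpectrum (𝓞 K), ¬ 𝔪 ≤ v.asIdeal ∧ ψ v ^ 2 ≠ 1)
    (D₂ : RayClassPrimitiveData 𝔪 (fun v ↦ ψ v ^ 2)) {s : ℂ} (hs : 1 < s.re) (hs2 : s.re ≤ 2) :
    (LSeries (twistVonMangoldt K (rayClassCoeffHom 𝔪 (fun v ↦ ψ v ^ 2))) s).re ≤ 77761 * modDiscBound K 𝔪 s.im := by
  have h𝔪 := D₂.modulus_ne_bot
  rw [← neg_neg (LSeries _ s), ← D₂.logDeriv_LMod_eq hs, ← logDeriv_apply]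
  have hL : D₂.L s ≠ 0 := D₂.L_ne_zero_of_one_le_re h2 hs.le
  have hP : D₂.eulerCorr s ≠ 0 := D₂.eulerCorr_ne_zero hs
  rw [show D₂.LMod = fun z ↦ D₂.L z * D₂.eulerCorr z from rfl,
    logDeriv_mul s hL hP D₂.differentiable.differentiableAt D₂.differentiable_eulerCorr.differentiableAt,
    neg_add, Complex.add_re]
  have h1 := D₂.re_neg_logDeriv_L_le h2 hs hs2
  have h3 : (-logDeriv D₂.eulerCorr s).re ≤ Real.log (Ideal.absNorm 𝔪 : ℕ) := by
    refine (Complex.re_le_norm _).trans ?_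
    rw [norm_neg]; exact D₂.norm_logDeriv_eulerCorr_le hs
  have h4 := rayDiscBound_le_modDiscBound (K := K) h𝔪 s.im
  have h5 : Real.log (Ideal.absNorm 𝔪 : ℕ) ≤ modDiscBound K 𝔪 s.im := by
    rw [modDiscBound]; linarith [discBound_nonneg K s.im]
  linarith

/-- **`Re L(Λ_{ψ²}, s) ≤ Re 1/(s−1) + 77761 M_{K,𝔪}(t)`** for `1 < σ ≤ 2` when `ψ²` is principal:
`L(Λ_{ψ²}) = Σ_{(𝔞,𝔪)=1} Λ(𝔞)N𝔞^{-s} = −ζ_K'/ζ_K − P₀'/P₀`, `P₀ = ∏_{𝔭∣𝔪}(1 − N𝔭^{-s})`.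
[cite: LagariasOdlyzko1977, Lemma 5.3] -/
theorem re_LSeries_twist_sq_le_of_principal (h𝔪 : 𝔪 ≠ ⊥)
    (h2 : ∀ v : HeightOneSpectrum (𝓞 K), ¬ 𝔪 ≤ v.asIdeal → ψ v ^ 2 = 1) {s : ℂ} (hs : 1 < s.re) (hs2 : s.re ≤ 2) :
    (LSeries (twistVonMangoldt K (rayClassCoeffHom 𝔪 (fun v ↦ ψ v ^ 2))) s).re ≤
      (1 / (s - 1)).re + 77761 * modDiscBound K 𝔪 s.im := by
  -- replace `ψ²` by the principal character
  have hcoeff : rayClassCoeffHom 𝔪 (fun v ↦ ψ v ^ 2) = rayClassCoeffHom 𝔪 (fun _ ↦ (1 : ℂ)) := by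
    ext I; rw [rayClassCoeffHom_apply, rayClassCoeffHom_apply]; exact rayClassCoeff_congr h𝔪 h2 I
  rw [hcoeff]
  -- the function `G₀(z) = ζ₁(z) P₀(z)/(z - 1)`, `= ζ_K(z) P₀(z) = L_𝔪(z, 1)` on `Re z > 1`
  set T := (Ideal.finite_factors h𝔪).toFinset with hT
  set P₀ : ℂ → ℂ := fun z ↦ ∏ v ∈ T, (1 - (1 : ℂ) * ((Ideal.absNorm v.asIdeal : ℕ) : ℂ) ^ (-z)) with hP₀
  have hTd : ∀ v ∈ T, v.asIdeal ∣ 𝔪 := fun v hv ↦ by rw [hT, Set.Finite.mem_toFinset, Set.mem_setOf_eq] at hv; exact hv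
  have hPd : Differentiable ℂ P₀ := by
    rw [hP₀]; exact Differentiable.fun_finsetProd fun v _ ↦ differentiable_eulerFactor 1 v
  set G₀ : ℂ → ℂ := fun z ↦ dedekindZeta₁ K z * P₀ z / (z - 1) with hG₀
  have hG₀eq : ∀ z : ℂ, 1 < z.re → G₀ z = rayClassLSeries 𝔪 (fun _ ↦ (1 : ℂ)) z := by
    intro z hz
    have hz1 : z - 1 ≠ 0 := sub_ne_zero.mpr fun h ↦ by rw [h, one_re] at hz; exact lt_irrefl _ hz
    rw [hG₀]; dsimp only
    rw [dedekindZeta₁_apply_eq_mul hz, AbelianDensity.rayClassLSeries_one_eq_dedekindZeta_mul_prod h𝔪 hz, hP₀, hT]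
    simp only [one_mul]
    field_simp
  have h1 : ∀ v : HeightOneSpectrum (𝓞 K), ¬ 𝔪 ≤ v.asIdeal → ‖(fun _ ↦ (1 : ℂ)) v‖ ≤ 1 := fun v _ ↦ by simp
  have hmain := neg_logDeriv_continuation_eq_LSeries h𝔪 h1 (L := G₀) hG₀eq hs
  rw [← hmain, ← logDeriv_apply]
  -- `logDeriv G₀ = logDeriv ζ₁ + logDeriv P₀ − 1/(s−1)`
  have hs1 : s - 1 ≠ 0 := sub_ne_zero.mpr fun h ↦ by rw [h, one_re] at hs; exact lt_irrefl _ hs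
  have hζ : dedekindZeta₁ K s ≠ 0 := dedekindZeta₁_ne_zero_of_one_le_re hs.le
  have hP : P₀ s ≠ 0 := by
    rw [hP₀]; exact Finset.prod_ne_zero_iff.mpr fun v _ ↦ one_sub_mul_cpow_ne_zero (by simp) v hs
  have hlog : logDeriv G₀ s = logDeriv (dedekindZeta₁ K) s + logDeriv P₀ s - (s - 1)⁻¹ := by
    rw [hG₀, logDeriv_div (f := fun z ↦ dedekindZeta₁ K z * P₀ z) (g := fun z : ℂ ↦ z - 1) s (mul_ne_zero hζ hP) hs1
      (((dedekindZeta₁_differentiable K).differentiableAt).mul hPd.differentiableAt)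
      (differentiableAt_id.sub_const 1),
      logDeriv_mul (f := dedekindZeta₁ K) (g := P₀) s hζ hP (dedekindZeta₁_differentiable K).differentiableAt
        hPd.differentiableAt]
    have : logDeriv (fun z : ℂ ↦ z - 1) s = (s - 1)⁻¹ := by
      rw [logDeriv_apply, show (fun z : ℂ ↦ z - 1) = fun z ↦ id z - 1 from rfl, deriv_sub_const, deriv_id]
      simp
    rw [this]
  rw [hlog, show -(logDeriv (dedekindZeta₁ K) s + logDeriv P₀ s - (s - 1)⁻¹) =
    (-(deriv (dedekindZeta₁ K) s / dedekindZeta₁ K s) + (s - 1)⁻¹) + -logDeriv P₀ s by rw [logDeriv_apply]; ring,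
    neg_logDeriv_dedekindZeta₁_add_inv_eq (K := K) hs, ← LSeries_vonMangoldtNorm_eq (K := K) hs, Complex.add_re]
  have hA := re_LSeries_vonMangoldtNorm_le (K := K) hs hs2
  have hB : (-logDeriv P₀ s).re ≤ Real.log (Ideal.absNorm 𝔪 : ℕ) := by
    refine (Complex.re_le_norm _).trans ?_
    rw [norm_neg, hP₀]
    exact norm_logDeriv_eulerProd_le h𝔪 hTd (c := fun _ ↦ (1 : ℂ)) (fun v _ ↦ by simp) hs
  have h4 := discBound_le_modDiscBound (K := K) 𝔪 s.im
  have h5 : Real.log (Ideal.absNorm 𝔪 : ℕ) ≤ modDiscBound K 𝔪 s.im := by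
    rw [modDiscBound]; linarith [discBound_nonneg K s.im]
  linarith

/-- **The datum for `ψ²` non-principal** (`pole = false`). [cite: ThornerZaman2019, Theorem 3.1] -/
theorem degreeUniformTwistedZFRData_of_ne (hψ : IsRayClassCharacter 𝔪 ψ)
    (hnt : ∃ v : HeightOneSpectrum (𝓞 K), ¬ 𝔪 ≤ v.asIdeal ∧ ψ v ≠ 1)
    (h2 : ∃ v : HeightOneSpectrum (𝓞 K), ¬ 𝔪 ≤ v.asIdeal ∧ ψ v ^ 2 ≠ 1) :
    DegreeUniformTwistedZFRData 1 2 11 77760 77761 false (modDiscBound K 𝔪)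
      (vonMangoldtNorm K) (twistVonMangoldt K (rayClassCoeffHom 𝔪 ψ))
      (twistVonMangoldt K (rayClassCoeffHom 𝔪 (fun v ↦ ψ v ^ 2))) D.LMod := by
  have h𝔪 := D.modulus_ne_bot
  obtain ⟨h0, hgr, hlow⟩ := D.zfrData_common hnt
  have hν : ∀ I, ‖rayClassCoeffHom 𝔪 ψ I‖ ≤ 1 := norm_rayClassCoeffHom_le h𝔪 D.norm_psi_le_one
  have hψ2 : IsRayClassCharacter 𝔪 (fun v ↦ ψ v ^ 2) := hψ.pow_apply 2
  set D₂ := rayClassPrimitiveData hψ2 h𝔪 h2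
  exact {
    eta_pos := one_pos
    eta_le_one := le_rfl
    G_nonneg := by norm_num
    G'_nonneg := by norm_num
    K₀_nonneg := by norm_num
    C₂_nonneg := by norm_num
    one_le_ell := one_le_modDiscBound 𝔪
    ell_two_mul_le := fun t ↦ by
      have := discBound_two_mul_le (K := K) t
      rw [modDiscBound, modDiscBound]; linarith [log_absNorm_nonneg 𝔪]
    ell_zero_le := fun t ↦ by
      have := discBound_zero_le_discBound (K := K) t
      rw [modDiscBound, modDiscBound]; linarith
    ell_le_of_near := fun t t' h ↦ by
      have := discBound_le_two_mul_of_near (K := K) t t' h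
      rw [modDiscBound, modDiscBound]; linarith [log_absNorm_nonneg 𝔪]
    nonneg := vonMangoldtNorm_nonneg
    summable := fun s hs ↦ LSeriesSummable_vonMangoldtNorm hs
    re_LSeries₀_le := h0
    norm_le₁ := norm_twistVonMangoldt_le hν
    norm_le₂ := norm_twistVonMangoldt_le (norm_rayClassCoeffHom_le h𝔪 (ψ := fun v ↦ ψ v ^ 2) D.norm_psi_sq_le_one)
    three_four_one := fun σ hσ t ↦ three_four_one hν (rayClassCoeffHom_sq 𝔪 ψ) hσ t
    differentiableOn := D.differentiable_LMod.differentiableOn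
    ne_zero := fun s hs ↦ D.LMod_ne_zero_of_one_lt_re hnt hs
    logDeriv_eq := fun s hs ↦ D.logDeriv_LMod_eq hs
    growth := fun s hs hs3 ↦ hgr s hs hs3
    lower := fun t ↦ by simpa using hlow t
    re_LSeries₂_le := fun s hs hs2 ↦ by
      have h := re_LSeries_twist_sq_le (ψ := ψ) h2 D₂ hs hs2
      simp only [Bool.false_eq_true, ↓reduceIte, zero_add]
      exact h
    reflect := fun h ↦ absurd h Bool.false_ne_true }

/-- **The datum for `ψ²` principal** (`ψ` real, `pole = true`). [cite: ThornerZaman2019, Theorem 3.1] -/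
theorem degreeUniformTwistedZFRData_of_eq
    (hnt : ∃ v : HeightOneSpectrum (𝓞 K), ¬ 𝔪 ≤ v.asIdeal ∧ ψ v ≠ 1)
    (h2 : ∀ v : HeightOneSpectrum (𝓞 K), ¬ 𝔪 ≤ v.asIdeal → ψ v ^ 2 = 1) :
    DegreeUniformTwistedZFRData 1 2 11 77760 77761 true (modDiscBound K 𝔪)
      (vonMangoldtNorm K) (twistVonMangoldt K (rayClassCoeffHom 𝔪 ψ))
      (twistVonMangoldt K (rayClassCoeffHom 𝔪 (fun v ↦ ψ v ^ 2))) D.LMod := by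
  have h𝔪 := D.modulus_ne_bot
  obtain ⟨h0, hgr, hlow⟩ := D.zfrData_common hnt
  have hν : ∀ I, ‖rayClassCoeffHom 𝔪 ψ I‖ ≤ 1 := norm_rayClassCoeffHom_le h𝔪 D.norm_psi_le_one
  -- a real character: `ψ(𝔭) = ±1`, `conj ψ = ψ` off `𝔪`
  have hreal : ∀ v : HeightOneSpectrum (𝓞 K), ¬ 𝔪 ≤ v.asIdeal → conj (ψ v) = ψ v := by
    intro v hv
    have h := h2 v hv
    rw [sq, mul_self_eq_one_iff] at h
    rcases h with h | h <;> rw [h] <;> simp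
  exact {
    eta_pos := one_pos
    eta_le_one := le_rfl
    G_nonneg := by norm_num
    G'_nonneg := by norm_num
    K₀_nonneg := by norm_num
    C₂_nonneg := by norm_num
    one_le_ell := one_le_modDiscBound 𝔪
    ell_two_mul_le := fun t ↦ by
      have := discBound_two_mul_le (K := K) t
      rw [modDiscBound, modDiscBound]; linarith [log_absNorm_nonneg 𝔪]
    ell_zero_le := fun t ↦ by
      have := discBound_zero_le_discBound (K := K) t
      rw [modDiscBound, modDiscBound]; linarith
    ell_le_of_near := fun t t' h ↦ by
      have := discBound_le_two_mul_of_near (K := K) t t' h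
      rw [modDiscBound, modDiscBound]; linarith [log_absNorm_nonneg 𝔪]
    nonneg := vonMangoldtNorm_nonneg
    summable := fun s hs ↦ LSeriesSummable_vonMangoldtNorm hs
    re_LSeries₀_le := h0
    norm_le₁ := norm_twistVonMangoldt_le hν
    norm_le₂ := norm_twistVonMangoldt_le (norm_rayClassCoeffHom_le h𝔪 (ψ := fun v ↦ ψ v ^ 2) D.norm_psi_sq_le_one)
    three_four_one := fun σ hσ t ↦ three_four_one hν (rayClassCoeffHom_sq 𝔪 ψ) hσ t
    differentiableOn := D.differentiable_LMod.differentiableOn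
    ne_zero := fun s hs ↦ D.LMod_ne_zero_of_one_lt_re hnt hs
    logDeriv_eq := fun s hs ↦ D.logDeriv_LMod_eq hs
    growth := fun s hs hs3 ↦ hgr s hs hs3
    lower := fun t ↦ by simpa using hlow t
    re_LSeries₂_le := fun s hs hs2 ↦ by
      have h := re_LSeries_twist_sq_le_of_principal (ψ := ψ) h𝔪 h2 hs hs2
      simp only [↓reduceIte]
      exact h
    reflect := fun _ ρ _ hρ ↦ by rw [D.LMod_conj hreal ρ, hρ, map_zero] }

end RayClassPrimitiveData

/-! ### The zero-free region with an absolute constant -/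

/-- **Zero-free region for Hecke `L`-functions of ray class characters with an ABSOLUTE constant**
([ThornerZaman2019, Theorem 3.1] for `χ ≠ 1`; Lagarias–Odlyzko Lemma 8.1): there is an absolute `c > 0` such that for
EVERY number field `K`, modulus `𝔪 ≠ 0`, ray class character `ψ mod 𝔪` non-principal on the primes `∤ 𝔪`, primitive data
`D` of `ψ` (entire `L(s, χ₀)`), and every zero `ρ` of `L(·, χ₀)` with `Re ρ > 1 − c/M_{K,𝔪}(Im ρ)`,
`M_{K,𝔪}(t) = log|d_K| + log N𝔪 + 3n_K + (n_K + 1) log(|t| + 7)`: `ψ` is real (`ψ(𝔭)² = 1` for `𝔭 ∤ 𝔪`) and the zero is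
real (`Im ρ = 0`). [cite: ThornerZaman2019, Theorem 3.1] -/
theorem exists_zeroFree_rayClass_absolute :
    ∃ c : ℝ, 0 < c ∧ ∀ (K : Type*) [Field K] [NumberField K] (𝔪 : Ideal (𝓞 K))
      (ψ : HeightOneSpectrum (𝓞 K) → ℂ), IsRayClassCharacter 𝔪 ψ →
      (∃ v : HeightOneSpectrum (𝓞 K), ¬ 𝔪 ≤ v.asIdeal ∧ ψ v ≠ 1) →
      ∀ (D : RayClassPrimitiveData 𝔪 ψ) (ρ : ℂ), D.L ρ = 0 →
        1 - c / modDiscBound K 𝔪 ρ.im < ρ.re →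
          (∀ v : HeightOneSpectrum (𝓞 K), ¬ 𝔪 ≤ v.asIdeal → ψ v ^ 2 = 1) ∧ ρ.im = 0 := by
  obtain ⟨c, hc, hzf⟩ := DegreeUniformTwistedZFRData.exists_zeroFree_const
    (η := 1) (G := 2) (G' := 11) (K₀ := 77760) (C₂ := 77761)
    one_pos (by norm_num) (by norm_num) (by norm_num) (by norm_num)
  refine ⟨c, hc, fun K _ _ 𝔪 ψ hψ hnt D ρ hρ hregion ↦ ?_⟩
  have hρ' : D.LMod ρ = 0 := by rw [RayClassPrimitiveData.LMod, hρ, zero_mul]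
  by_cases h2 : ∀ v : HeightOneSpectrum (𝓞 K), ¬ 𝔪 ≤ v.asIdeal → ψ v ^ 2 = 1
  · have hdat := D.degreeUniformTwistedZFRData_of_eq hnt h2
    exact ⟨h2, (hzf _ _ _ _ _ _ hdat ρ hρ' hregion).2⟩
  · push Not at h2
    have hdat := D.degreeUniformTwistedZFRData_of_ne hψ hnt h2
    have := (hzf _ _ _ _ _ _ hdat ρ hρ' hregion).1
    exact absurd this Bool.false_ne_true

end Literature.NumberTheory.LFunctions

end
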